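import Literature.Analysis.FluidPDE.FractionalNSPrescribedEnergyProlongationProofs
import Literature.Analysis.FunctionSpaces.TorusWeakFormBookkeeping
import Literature.Analysis.FunctionSpaces.TorusAxisAverage
import Literature.Analysis.FunctionSpaces.TorusFluidGlue
import Literature.Analysis.FluidPDE.LerayHopf
import HarnessLib

/-!
# Gluing weak solutions of the Navier–Stokes equations on the flat torus in time

Analysis/FluidPDE support file (all proved, no definitions). For the accepted pressure-free weak
formulation with initial datum on `T^d × [0, T)`, `Torus.IsWeakNSSolutionWithDataOn T ν u₀ u`
(Temam 1984, Ch. III §1.1, (1.22)–(1.23); `Literature/Analysis/FunctionSpaces/TorusFluidGlue`),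
whose fields are only `L²((0,T) × T^d)`, we prove:

* integrability in time of the pairings `t ↦ ∫⟪u(t), χ(t)⟫` and of the weak-form functional
  `Φ(t) = ∫ (⟪u, ∂ₜψ⟫ + ⟪u, (u·∇)ψ⟫ + ν⟪u, Δψ⟫)(t)` on `(0, T)` for `L²ₜL²ₓ` fields
  (Fubini measurability from the space–time measurability clause, domination by `1 + ∫‖u(t)‖²`);
* `IsWeakNSSolutionWithDataOn.test_smul_time` — the weak identity tested with a product
  `η(t) ψ(t, x)` of a smooth time cutoff and a (time-dependent) test field:
  `∫_{(0,T)} (η' P + η Φ) + η(0) ∫⟪u₀, ψ(0)⟫ = 0`, `P(t) = ∫⟪u(t), ψ(t)⟫`;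
* `IsWeakNSSolutionWithDataOn.integral_inner_eq_of_continuousOn` — **the trace identity at an
  interior time of continuity**: if `u` is continuous on a slab `[a₁, a₂] × T^d` and
  `a ∈ (a₁, a₂)`, `0 < a < T`, then `∫⟪u(a), ψ(a)⟫ = ∫⟪u₀, ψ(0)⟫ + ∫_{(0,a)} Φ` for every smooth
  divergence-free test field `ψ` on `[0, T)` (du Bois-Reymond lemma with initial datum in the
  a.e. form, `Literature.Analysis.FunctionSpaces.ae_eq_add_setIntegral_of_forall_test`, evaluated at the continuity
  point `a`);
* `IsWeakNSSolutionWithDataOn.glue` — **gluing in time**: if `u` is a weak solution on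
  `[0, T)` with datum `u₀`, continuous on a slab around the time `a ∈ (0, T)`, and `w` is a weak
  solution on `[0, T - a)` with datum `u(a)`, then `t ↦ u(t)` (`t ≤ a`), `w(t - a)` (`t > a`) is a
  weak solution on `[0, T)` with datum `u₀`.

This is the (folklore) concatenation step in Cheskidov–Luo 2022, proof of Thm. 1.6 (§2.6: "the
glued solution `u ∈ L^p L^∞` is still a weak solution due the smoothness of both `v` and `ũ` near
`t = a`"), used in `Literature/Barriers/NavierStokesRegularity/SharpLpLinftyNonuniquenessProofs`.

## References

* R. Temam, *Navier–Stokes Equations*, 3rd ed. (1984), Ch. III §1.1, (1.22)–(1.25), Lemma 1.1.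
* G. P. Galdi, *An introduction to the Navier–Stokes initial-boundary value problem* (2000),
  Lemma 2.1.
* A. Cheskidov, X. Luo, *Sharp nonuniqueness for the Navier–Stokes equations*, Invent. Math. 229
  (2022), §2.6. [`CheskidovLuo2022`]
-/

noncomputable section

open MeasureTheory Set Filter Topology Function UnitAddTorus
open scoped ENNReal NNReal InnerProductSpace ContDiff

namespace Literature.Analysis.FluidPDE

namespace Torus

variable {d : Type*} [Fintype d] [DecidableEq d]

/-! ## `L²ₜL²ₓ` fields on `(0, T) × T^d`: slices and time integrability -/

section L2Fields

variable {T : ℝ} {U : ℝ → UnitAddTorus d → EuclideanSpace ℝ d}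

omit [DecidableEq d] in
/-- Almost every time slice of a field which is space–time measurable on `(0,T) × T^d` and
square integrable there lies in `L²(T^d)` (Tonelli). [folklore] -/
theorem ae_memLp_two_slice_of_lintegral
    (hm : AEStronglyMeasurable (FunctionSpaces.Torus.stLift U) (volume.restrict (Ioo 0 T ×ˢ univ)))
    (h2 : ∫⁻ t in Ioo 0 T, ∫⁻ x, ‖U t x‖ₑ ^ 2 < ⊤) :
    ∀ᵐ t ∂(volume.restrict (Ioo 0 T)), MemLp (U t) 2 volume := by
  have hF := FunctionSpaces.Torus.aestronglyMeasurable_uncurry_of_stLift_prod hm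
  have hmeas : ∀ᵐ t ∂(volume.restrict (Ioo 0 T)), AEStronglyMeasurable (U t) volume :=
    hF.prodMk_left
  have hint : AEMeasurable (fun t => ∫⁻ x, ‖U t x‖ₑ ^ 2) (volume.restrict (Ioo 0 T)) :=
    (hF.aemeasurable.enorm.pow_const 2).lintegral_prod_right'
  have hfin : ∀ᵐ t ∂(volume.restrict (Ioo 0 T)), ∫⁻ x, ‖U t x‖ₑ ^ 2 < ⊤ :=
    ae_lt_top' hint h2.ne
  filter_upwards [hmeas, hfin] with t ht ht'
  refine ⟨ht, (eLpNorm_lt_top_iff_lintegral_rpow_enorm_lt_top two_ne_zero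
    ENNReal.ofNat_ne_top).2 ?_⟩
  simpa only [ENNReal.toReal_ofNat, ENNReal.rpow_two] using ht'

omit [DecidableEq d] in
/-- For an `L²ₜL²ₓ` field on `(0,T) × T^d`, `t ↦ ∫ ‖U t‖²` is integrable on `(0, T)`. [folklore] -/
theorem integrableOn_integral_norm_sq
    (hm : AEStronglyMeasurable (FunctionSpaces.Torus.stLift U) (volume.restrict (Ioo 0 T ×ˢ univ)))
    (h2 : ∫⁻ t in Ioo 0 T, ∫⁻ x, ‖U t x‖ₑ ^ 2 < ⊤) :
    IntegrableOn (fun t => ∫ x, ‖U t x‖ ^ 2) (Ioo 0 T) := by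
  have hF := FunctionSpaces.Torus.aestronglyMeasurable_uncurry_of_stLift_prod hm
  have hint : AEMeasurable (fun t => ∫⁻ x, ‖U t x‖ₑ ^ 2) (volume.restrict (Ioo 0 T)) :=
    (hF.aemeasurable.enorm.pow_const 2).lintegral_prod_right'
  have h1 : Integrable (fun t => (∫⁻ x, ‖U t x‖ₑ ^ 2).toReal) (volume.restrict (Ioo 0 T)) :=
    integrable_toReal_of_lintegral_ne_top hint h2.ne
  refine h1.congr ?_
  filter_upwards [ae_memLp_two_slice_of_lintegral hm h2] with t ht
  rw [lintegral_enorm_sq_eq_ofReal ht, ENNReal.toReal_ofReal (integral_nonneg fun x => by positivity)]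

omit [DecidableEq d] in
/-- **Time integrability of a pairing.** For an `L²ₜL²ₓ` field `U` on `(0,T) × T^d` and a jointly
continuous field `χ` bounded by `M` on `(0,T) × T^d`, `t ↦ ∫⟪U t, χ t⟫` is integrable on `(0,T)`
(`|∫⟪U,χ⟫| ≤ M ∫‖U‖ ≤ M · ½(1 + ∫‖U‖²)`). [folklore] -/
theorem integrableOn_integral_inner_of_lintegral
    (hm : AEStronglyMeasurable (FunctionSpaces.Torus.stLift U) (volume.restrict (Ioo 0 T ×ˢ univ)))
    (h2 : ∫⁻ t in Ioo 0 T, ∫⁻ x, ‖U t x‖ₑ ^ 2 < ⊤) {χ : ℝ → UnitAddTorus d → EuclideanSpace ℝ d}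
    (hχ : Continuous (uncurry χ)) {M : ℝ} (hM : ∀ t ∈ Ioo 0 T, ∀ x, ‖χ t x‖ ≤ M) :
    IntegrableOn (fun t => ∫ x, ⟪U t x, χ t x⟫_ℝ) (Ioo 0 T) := by
  have hF := FunctionSpaces.Torus.aestronglyMeasurable_uncurry_of_stLift_prod hm
  have hF2 : AEStronglyMeasurable (fun p : ℝ × UnitAddTorus d => ⟪U p.1 p.2, χ p.1 p.2⟫_ℝ)
      ((volume.restrict (Ioo 0 T)).prod (volume : Measure (UnitAddTorus d))) :=
    hF.inner hχ.aestronglyMeasurable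
  have hmeas : AEStronglyMeasurable (fun t => ∫ x, ⟪U t x, χ t x⟫_ℝ) (volume.restrict (Ioo 0 T)) :=
    hF2.integral_prod_right'
  have hM0 : ∀ t ∈ Ioo 0 T, 0 ≤ M := fun t ht => (norm_nonneg _).trans (hM t ht 0)
  refine Integrable.mono' (((integrableOn_const (measure_Ioo_lt_top (a := (0 : ℝ)) (b := T)).ne
    (C := (1 : ℝ))).add (integrableOn_integral_norm_sq hm h2)).const_mul (|M| * 2⁻¹)) hmeas ?_
  filter_upwards [ae_memLp_two_slice_of_lintegral hm h2, ae_restrict_mem measurableSet_Ioo]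
    with t ht htI
  rw [Real.norm_eq_abs]
  calc |∫ x, ⟪U t x, χ t x⟫_ℝ| ≤ M * ∫ x, ‖U t x‖ :=
        abs_integral_inner_le_of_norm_le (ht.integrable one_le_two) (hM t htI)
    _ ≤ |M| * (2⁻¹ * (1 + ∫ x, ‖U t x‖ ^ 2)) :=
        (mul_le_mul_of_nonneg_right (le_abs_self M) (integral_nonneg fun x => norm_nonneg _)).trans
          (mul_le_mul_of_nonneg_left (integral_norm_le_of_memLp_two ht) (abs_nonneg M))
    _ = |M| * 2⁻¹ * (1 + ∫ x, ‖U t x‖ ^ 2) := by ring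

/-- **Slice estimate for the weak-form functional**: for `U ∈ L²(T^d)`, a smooth `b` with
`∑ᵢ ‖∂ᵢ b‖ ≤ C`, continuous `p`, `L` with `‖p‖ ≤ K_p`, `‖L‖ ≤ K_L`,
`|∫ (⟪U, p⟫ + ⟪U, (U·∇)b⟫ + ν⟪U, L⟫)| ≤ (K_p + |ν| K_L) · ½(1 + ∫‖U‖²) + C ∫‖U‖²`. [folklore] -/
theorem abs_nsWeakFunctional_slice_le {U b p L : UnitAddTorus d → EuclideanSpace ℝ d}
    (hU : MemLp U 2 volume) (hb : FunctionSpaces.Torus.IsSmooth b) (hp : Continuous p) (hL : Continuous L)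
    {C Kp KL : ℝ} (hC : ∀ x, ∑ i, ‖FunctionSpaces.Torus.partialDeriv i b x‖ ≤ C)
    (hKp : ∀ x, ‖p x‖ ≤ Kp) (hKL : ∀ x, ‖L x‖ ≤ KL) (ν : ℝ) :
    |∫ x, (⟪U x, p x⟫_ℝ + ⟪U x, FunctionSpaces.Torus.convect U b x⟫_ℝ + ν * ⟪U x, L x⟫_ℝ)| ≤
      (Kp + |ν| * KL) * (2⁻¹ * (1 + ∫ x, ‖U x‖ ^ 2)) + C * ∫ x, ‖U x‖ ^ 2 := by
  have i1 : Integrable (fun x => ⟪U x, p x⟫_ℝ) volume :=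
    FunctionSpaces.Torus.integrable_inner_of_continuous (hU.integrable one_le_two) hp
  have i2 : Integrable (fun x => ⟪U x, FunctionSpaces.Torus.convect U b x⟫_ℝ) volume :=
    integrable_inner_convect_self hU hb
  have i3 : Integrable (fun x => ⟪U x, L x⟫_ℝ) volume :=
    FunctionSpaces.Torus.integrable_inner_of_continuous (hU.integrable one_le_two) hL
  have i12 : Integrable (fun x => ⟪U x, p x⟫_ℝ + ⟪U x, FunctionSpaces.Torus.convect U b x⟫_ℝ) volume :=
    i1.add i2
  have i3' : Integrable (fun x => ν * ⟪U x, L x⟫_ℝ) volume := i3.const_mul ν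
  rw [integral_add i12 i3', integral_add i1 i2, integral_const_mul]
  have b1 := abs_integral_inner_le_of_norm_le (hU.integrable one_le_two) hKp
  have b2 := abs_integral_inner_convect_self_le hU hb hC
  have b3 := abs_integral_inner_le_of_norm_le (hU.integrable one_le_two) hKL
  have b4 := integral_norm_le_of_memLp_two hU
  have hKp0 : 0 ≤ Kp := (norm_nonneg _).trans (hKp 0)
  have hKL0 : 0 ≤ KL := (norm_nonneg _).trans (hKL 0)
  have hI1 : 0 ≤ ∫ x, ‖U x‖ := integral_nonneg fun x => norm_nonneg _
  have htri : |(∫ x, ⟪U x, p x⟫_ℝ) + (∫ x, ⟪U x, FunctionSpaces.Torus.convect U b x⟫_ℝ) +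
      ν * ∫ x, ⟪U x, L x⟫_ℝ| ≤ |∫ x, ⟪U x, p x⟫_ℝ| + |∫ x, ⟪U x, FunctionSpaces.Torus.convect U b x⟫_ℝ| +
      |ν| * |∫ x, ⟪U x, L x⟫_ℝ| := by
    rw [← abs_mul]
    exact (abs_add_le _ _).trans (add_le_add (abs_add_le _ _) le_rfl)
  have h5 : |ν| * |∫ x, ⟪U x, L x⟫_ℝ| ≤ |ν| * (KL * ∫ x, ‖U x‖) :=
    mul_le_mul_of_nonneg_left b3 (abs_nonneg ν)
  have h6 : (Kp + |ν| * KL) * ∫ x, ‖U x‖ ≤ (Kp + |ν| * KL) * (2⁻¹ * (1 + ∫ x, ‖U x‖ ^ 2)) :=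
    mul_le_mul_of_nonneg_left b4 (by positivity)
  nlinarith

/-- **Time-measurability of the weak-form functional** `t ↦ ∫ (⟪U,∂ₜψ⟫ + ⟪U,(U·∇)ψ⟫ + ν⟪U,Δψ⟫)(t)`
of a space–time measurable field against a test field, on `(0, T)` (Fubini). [folklore] -/
theorem aestronglyMeasurable_nsWeakFunctional {S₀ ν : ℝ}
    (hm : AEStronglyMeasurable (FunctionSpaces.Torus.stLift U) (volume.restrict (Ioo 0 T ×ˢ univ)))
    {ψ : ℝ → UnitAddTorus d → EuclideanSpace ℝ d} (hψ : FunctionSpaces.Torus.IsSpaceTimeTest S₀ ψ) :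
    AEStronglyMeasurable (fun t => ∫ x, (⟪U t x, FunctionSpaces.Torus.timeDeriv ψ t x⟫_ℝ +
      ⟪U t x, FunctionSpaces.Torus.convect (U t) (ψ t) x⟫_ℝ + ν * ⟪U t x, FunctionSpaces.Torus.laplacian (ψ t) x⟫_ℝ))
      (volume.restrict (Ioo 0 T)) := by
  have hu' := FunctionSpaces.Torus.aestronglyMeasurable_uncurry_of_stLift_prod hm
  have hp : Continuous (uncurry (FunctionSpaces.Torus.timeDeriv ψ)) :=
    FunctionSpaces.Torus.continuous_uncurry_of_continuous_stLift hψ.timeDeriv.1.continuous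
  have hL : Continuous (uncurry fun t => FunctionSpaces.Torus.laplacian (ψ t)) :=
    FunctionSpaces.Torus.continuous_uncurry_of_continuous_stLift
      hψ.isSmoothSpaceTimeOn_laplacian.continuous_stLift_of_univ
  have hD : ∀ i, Continuous (uncurry fun t => FunctionSpaces.Torus.partialDeriv i (ψ t)) := fun i =>
    FunctionSpaces.Torus.continuous_uncurry_of_continuous_stLift
      (hψ.isSmoothSpaceTimeOn_partialDeriv i).continuous_stLift_of_univ
  have h : AEStronglyMeasurable (fun q : ℝ × UnitAddTorus d =>
      ⟪uncurry U q, uncurry (FunctionSpaces.Torus.timeDeriv ψ) q⟫_ℝ +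
      ⟪uncurry U q, ∑ i, (uncurry U q) i • uncurry (fun t => FunctionSpaces.Torus.partialDeriv i (ψ t)) q⟫_ℝ +
      ν * ⟪uncurry U q, uncurry (fun t => FunctionSpaces.Torus.laplacian (ψ t)) q⟫_ℝ)
      ((volume.restrict (Ioo 0 T)).prod volume) :=
    ((hu'.inner hp.aestronglyMeasurable).add (hu'.inner (Finset.aestronglyMeasurable_fun_sum _
      fun i _ => ((EuclideanSpace.proj (𝕜 := ℝ) i).continuous.comp_aestronglyMeasurable hu').smul
        (hD i).aestronglyMeasurable))).add ((hu'.inner hL.aestronglyMeasurable).const_mul ν)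
  refine h.integral_prod_right'.congr (ae_of_all _ fun t => ?_)
  refine integral_congr_ae (ae_of_all _ fun x => ?_)
  simp only [uncurry_apply_pair, FunctionSpaces.Torus.convect]
  rw [FunctionSpaces.Torus.fderiv_apply_eq_sum_partialDeriv ((hψ.isSmooth_slice t).isContDiff (by simp))]

/-- **Integrability on `(0, T)` of the weak-form functional of an `L²ₜL²ₓ` field** against a test
field on `[0, T)`: measurable by Fubini, dominated by `A (1 + ∫‖U(t)‖²)` with the uniform bounds
of the test data on `[0, T]` (`abs_nsWeakFunctional_slice_le`). This makes the Bochner time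
integral in `Torus.IsWeakNSSolutionWithDataOn` a genuine integral. [folklore] -/
theorem integrableOn_nsWeakFunctional {ν : ℝ}
    (hm : AEStronglyMeasurable (FunctionSpaces.Torus.stLift U) (volume.restrict (Ioo 0 T ×ˢ univ)))
    (h2 : ∫⁻ t in Ioo 0 T, ∫⁻ x, ‖U t x‖ₑ ^ 2 < ⊤)
    {ψ : ℝ → UnitAddTorus d → EuclideanSpace ℝ d} (hψ : FunctionSpaces.Torus.IsSpaceTimeTest T ψ) :
    IntegrableOn (fun t => ∫ x, (⟪U t x, FunctionSpaces.Torus.timeDeriv ψ t x⟫_ℝ +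
      ⟪U t x, FunctionSpaces.Torus.convect (U t) (ψ t) x⟫_ℝ + ν * ⟪U t x, FunctionSpaces.Torus.laplacian (ψ t) x⟫_ℝ))
      (Ioo 0 T) := by
  obtain ⟨Kp, KL, -, C, hC0, hKp, hKL, -, hC⟩ := hψ.exists_bounds
  have hKp0 : ∀ t ∈ Ioo 0 T, 0 ≤ Kp := fun t ht => (norm_nonneg _).trans (hKp t (Ioo_subset_Icc_self ht) 0)
  have hKL0 : ∀ t ∈ Ioo 0 T, 0 ≤ KL := fun t ht => (norm_nonneg _).trans (hKL t (Ioo_subset_Icc_self ht) 0)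
  set g : ℝ → ℝ := fun t => (|Kp| + |ν| * |KL|) * (2⁻¹ * (1 + ∫ x, ‖U t x‖ ^ 2)) +
    C * (1 + ∫ x, ‖U t x‖ ^ 2) with hg
  have hone : IntegrableOn (fun t => (1 : ℝ) + ∫ x, ‖U t x‖ ^ 2) (Ioo 0 T) :=
    (integrableOn_const (measure_Ioo_lt_top (a := (0 : ℝ)) (b := T)).ne (C := (1 : ℝ))).add
      (integrableOn_integral_norm_sq hm h2)
  have hgi : IntegrableOn g (Ioo 0 T) :=
    ((hone.const_mul (2⁻¹ : ℝ)).const_mul _).add (hone.const_mul C)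
  refine Integrable.mono' hgi (aestronglyMeasurable_nsWeakFunctional hm hψ) ?_
  filter_upwards [ae_memLp_two_slice_of_lintegral hm h2, ae_restrict_mem measurableSet_Ioo]
    with t ht htI
  have htI' : t ∈ Icc 0 T := Ioo_subset_Icc_self htI
  rw [Real.norm_eq_abs]
  refine (abs_nsWeakFunctional_slice_le ht (hψ.isSmooth_slice t) (hψ.timeDeriv.isSmooth_slice t).continuous
    (hψ.isSmooth_slice t).laplacian.continuous (hC t htI') (fun x => (hKp t htI' x).trans (le_abs_self _))
    (fun x => (hKL t htI' x).trans (le_abs_self _)) ν).trans ?_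
  rw [hg]
  have hI : 0 ≤ ∫ x, ‖U t x‖ ^ 2 := integral_nonneg fun x => by positivity
  nlinarith [abs_nonneg Kp, abs_nonneg KL, abs_nonneg ν]

end L2Fields

/-! ## Testing the weak formulation with `η(t) ψ(t, x)`; the trace at a time of continuity -/

section Trace

variable {T ν : ℝ} {u : ℝ → UnitAddTorus d → EuclideanSpace ℝ d} {u₀ : UnitAddTorus d → EuclideanSpace ℝ d}
  {ψ : ℝ → UnitAddTorus d → EuclideanSpace ℝ d}

omit [DecidableEq d] in
/-- The product `η(t) ψ(t, x)` of a smooth `η : ℝ → ℝ` with a space–time test field on `[0, T)`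
is a space–time test field on `[0, T)` (the time support is that of `ψ`). [folklore] -/
theorem isSpaceTimeTest_smul_time {F : Type*} [NormedAddCommGroup F] [NormedSpace ℝ F]
    {ψ : ℝ → UnitAddTorus d → F} {η : ℝ → ℝ} (hη : ContDiff ℝ ∞ η)
    (hψ : FunctionSpaces.Torus.IsSpaceTimeTest T ψ) :
    FunctionSpaces.Torus.IsSpaceTimeTest T (fun t x => η t • ψ t x) := by
  obtain ⟨hs, T', hT', h0⟩ := hψ
  refine ⟨?_, T', hT', fun t ht => ?_⟩
  · have h : FunctionSpaces.Torus.stLift (fun t x => η t • ψ t x) =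
        fun p : ℝ × EuclideanSpace ℝ d => η p.1 • FunctionSpaces.Torus.stLift ψ p := by
      funext p
      rfl
    rw [h]
    exact (hη.comp contDiff_fst).smul hs
  · funext x
    simp [h0 t ht]

/-- **The weak formulation with datum tested with a product `η(t) ψ(t, x)`.** Let `u` be a weak
solution with datum `u₀` on `T^d × [0, T)` (`Torus.IsWeakNSSolutionWithDataOn`), `ψ` a smooth
divergence-free test field on `[0, T)` and `η ∈ C^∞(ℝ)`. With `P(t) = ∫⟪u(t), ψ(t)⟫` and
`Φ(t) = ∫ (⟪u, ∂ₜψ⟫ + ⟪u, (u·∇)ψ⟫ + ν⟪u, Δψ⟫)(t)`,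
`∫_{(0,T)} (η' P + η Φ) + η(0) ∫⟪u₀, ψ(0)⟫ = 0` (product rule in time and linearity of
`(u·∇)`, `Δ` in the test field; the slices `u(t) ∈ L²` for a.e. `t`)
(Temam 1984, Ch. III (1.22)–(1.24); Galdi 2000, proof of Lemma 2.1). [folklore] -/
theorem _root_.Literature.Analysis.FunctionSpaces.Torus.IsWeakNSSolutionWithDataOn.test_smul_time
    (hu : FunctionSpaces.Torus.IsWeakNSSolutionWithDataOn T ν u₀ u)
    (hψ : FunctionSpaces.Torus.IsSpaceTimeTest T ψ) (hdiv : FunctionSpaces.Torus.IsDivFreeTest ψ)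
    {η : ℝ → ℝ} (hη : ContDiff ℝ ∞ η) :
    (∫ t in Ioo 0 T, (deriv η t * (∫ x, ⟪u t x, ψ t x⟫_ℝ) + η t *
      ∫ x, (⟪u t x, FunctionSpaces.Torus.timeDeriv ψ t x⟫_ℝ +
        ⟪u t x, FunctionSpaces.Torus.convect (u t) (ψ t) x⟫_ℝ +
        ν * ⟪u t x, FunctionSpaces.Torus.laplacian (ψ t) x⟫_ℝ))) + η 0 * ∫ x, ⟪u₀ x, ψ 0 x⟫_ℝ = 0 := by
  obtain ⟨hm, h2, -, hweak⟩ := hu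
  have hid := hweak (fun t x => η t • ψ t x) (isSpaceTimeTest_smul_time hη hψ)
    (isDivFreeTest_smul' η hdiv)
  have hinit : ∫ x, ⟪u₀ x, η 0 • ψ 0 x⟫_ℝ = η 0 * ∫ x, ⟪u₀ x, ψ 0 x⟫_ℝ := by
    simp only [real_inner_smul_right]
    exact integral_const_mul _ _
  have hslice : ∀ᵐ t ∂(volume.restrict (Ioo 0 T)),
      ∫ x, (⟪u t x, FunctionSpaces.Torus.timeDeriv (fun s y => η s • ψ s y) t x⟫_ℝ +
        ⟪u t x, FunctionSpaces.Torus.convect (u t) (fun y => η t • ψ t y) x⟫_ℝ +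
        ν * ⟪u t x, FunctionSpaces.Torus.laplacian (fun y => η t • ψ t y) x⟫_ℝ) =
      deriv η t * (∫ x, ⟪u t x, ψ t x⟫_ℝ) + η t *
        ∫ x, (⟪u t x, FunctionSpaces.Torus.timeDeriv ψ t x⟫_ℝ +
          ⟪u t x, FunctionSpaces.Torus.convect (u t) (ψ t) x⟫_ℝ +
          ν * ⟪u t x, FunctionSpaces.Torus.laplacian (ψ t) x⟫_ℝ) := by
    filter_upwards [ae_memLp_two_slice_of_lintegral hm h2] with t ht
    have hC1 : FunctionSpaces.Torus.IsContDiff 1 (ψ t) := (hψ.isSmooth_slice t).isContDiff (by simp)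
    have hpt : ∀ x, ⟪u t x, FunctionSpaces.Torus.timeDeriv (fun s y => η s • ψ s y) t x⟫_ℝ +
        ⟪u t x, FunctionSpaces.Torus.convect (u t) (fun y => η t • ψ t y) x⟫_ℝ +
        ν * ⟪u t x, FunctionSpaces.Torus.laplacian (fun y => η t • ψ t y) x⟫_ℝ =
        deriv η t * ⟪u t x, ψ t x⟫_ℝ + η t * (⟪u t x, FunctionSpaces.Torus.timeDeriv ψ t x⟫_ℝ +
          ⟪u t x, FunctionSpaces.Torus.convect (u t) (ψ t) x⟫_ℝ +
          ν * ⟪u t x, FunctionSpaces.Torus.laplacian (ψ t) x⟫_ℝ) := by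
      intro x
      rw [timeDeriv_smul' (hη.differentiable (by simp)) hψ.1, convect_const_smul (u t) hC1 (η t) x,
        laplacian_const_smul (hψ.isSmooth_slice t) (η t) x]
      simp only [inner_add_right, real_inner_smul_right]
      ring
    have hi : Integrable (u t) volume := ht.integrable one_le_two
    have i1 : Integrable (fun x => ⟪u t x, ψ t x⟫_ℝ) volume :=
      FunctionSpaces.Torus.integrable_inner_of_continuous hi (hψ.isSmooth_slice t).continuous
    have i2 : Integrable (fun x => ⟪u t x, FunctionSpaces.Torus.timeDeriv ψ t x⟫_ℝ +
        ⟪u t x, FunctionSpaces.Torus.convect (u t) (ψ t) x⟫_ℝ +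
        ν * ⟪u t x, FunctionSpaces.Torus.laplacian (ψ t) x⟫_ℝ) volume :=
      ((FunctionSpaces.Torus.integrable_inner_of_continuous hi
        (hψ.timeDeriv.isSmooth_slice t).continuous).add
        (integrable_inner_convect_self ht (hψ.isSmooth_slice t))).add
        ((FunctionSpaces.Torus.integrable_inner_of_continuous hi
          (hψ.isSmooth_slice t).laplacian.continuous).const_mul ν)
    calc ∫ x, (⟪u t x, FunctionSpaces.Torus.timeDeriv (fun s y => η s • ψ s y) t x⟫_ℝ +
          ⟪u t x, FunctionSpaces.Torus.convect (u t) (fun y => η t • ψ t y) x⟫_ℝ +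
          ν * ⟪u t x, FunctionSpaces.Torus.laplacian (fun y => η t • ψ t y) x⟫_ℝ)
        = ∫ x, (deriv η t * ⟪u t x, ψ t x⟫_ℝ + η t * (⟪u t x, FunctionSpaces.Torus.timeDeriv ψ t x⟫_ℝ +
            ⟪u t x, FunctionSpaces.Torus.convect (u t) (ψ t) x⟫_ℝ +
            ν * ⟪u t x, FunctionSpaces.Torus.laplacian (ψ t) x⟫_ℝ)) :=
          integral_congr_ae (ae_of_all _ hpt)
      _ = _ := by
          rw [integral_add (i1.const_mul _) (i2.const_mul _), integral_const_mul, integral_const_mul]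
  rw [integral_congr_ae hslice, hinit] at hid
  exact hid

/-- **The trace identity at an interior time of continuity.** Let `u` be a weak solution with
datum `u₀` on `T^d × [0, T)` whose space–time lift is continuous on a slab `[a₁, a₂] × ℝ^d`, and
let `a ∈ (a₁, a₂)` with `0 < a < T`. Then for every smooth divergence-free test field `ψ` on
`[0, T)`,
`∫⟪u(a), ψ(a)⟫ = ∫⟪u₀, ψ(0)⟫ + ∫_{(0,a)} ∫ (⟪u, ∂ₜψ⟫ + ⟪u, (u·∇)ψ⟫ + ν⟪u, Δψ⟫)`.
Proof: by `test_smul_time` the pairing `P(t) = ∫⟪u(t), ψ(t)⟫` and the functional `Φ` satisfy the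
hypothesis of the du Bois-Reymond lemma with initial datum in its a.e. form
(`Literature.Analysis.FunctionSpaces.ae_eq_add_setIntegral_of_forall_test`), so `P = ∫⟪u₀, ψ(0)⟫ + ∫_{(0,·]} Φ` a.e. on
`(0, T)`; both sides are continuous near `a`, hence equal at `a`
(`MeasureTheory.Measure.eqOn_open_of_ae_eq`) (Temam 1984, Ch. III §1.1, (1.22)–(1.25) and
Lemma 1.1; Galdi 2000, Lemma 2.1). [folklore] -/
theorem _root_.Literature.Analysis.FunctionSpaces.Torus.IsWeakNSSolutionWithDataOn.integral_inner_eq_of_continuousOn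
    (hu : FunctionSpaces.Torus.IsWeakNSSolutionWithDataOn T ν u₀ u) {a a₁ a₂ : ℝ} (ha0 : 0 < a) (haT : a < T)
    (ha : a ∈ Ioo a₁ a₂) (hc : ContinuousOn (FunctionSpaces.Torus.stLift u) (Icc a₁ a₂ ×ˢ univ))
    (hψ : FunctionSpaces.Torus.IsSpaceTimeTest T ψ) (hdiv : FunctionSpaces.Torus.IsDivFreeTest ψ) :
    ∫ x, ⟪u a x, ψ a x⟫_ℝ = (∫ x, ⟪u₀ x, ψ 0 x⟫_ℝ) +
      ∫ t in Ioo 0 a, ∫ x, (⟪u t x, FunctionSpaces.Torus.timeDeriv ψ t x⟫_ℝ +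
        ⟪u t x, FunctionSpaces.Torus.convect (u t) (ψ t) x⟫_ℝ +
        ν * ⟪u t x, FunctionSpaces.Torus.laplacian (ψ t) x⟫_ℝ) := by
  set P : ℝ → ℝ := fun t => ∫ x, ⟪u t x, ψ t x⟫_ℝ with hP
  set Φ : ℝ → ℝ := fun t => ∫ x, (⟪u t x, FunctionSpaces.Torus.timeDeriv ψ t x⟫_ℝ +
    ⟪u t x, FunctionSpaces.Torus.convect (u t) (ψ t) x⟫_ℝ +
    ν * ⟪u t x, FunctionSpaces.Torus.laplacian (ψ t) x⟫_ℝ) with hΦ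
  set D : ℝ := ∫ x, ⟪u₀ x, ψ 0 x⟫_ℝ with hD
  have hT : 0 < T := ha0.trans haT
  -- integrability of `P` and `Φ` on `(0, T)`
  obtain ⟨-, -, Kq, -, -, -, -, hKq, -⟩ := hψ.exists_bounds
  have hPi : IntegrableOn P (Ioo 0 T) :=
    integrableOn_integral_inner_of_lintegral hu.1 hu.2.1 hψ.continuous_uncurry
      (fun t ht x => hKq t (Ioo_subset_Icc_self ht) x)
  have hΦi : IntegrableOn Φ (Ioo 0 T) := integrableOn_nsWeakFunctional hu.1 hu.2.1 hψ
  -- the du Bois-Reymond lemma with initial datum, a.e. form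
  have hae : ∀ᵐ t ∂(volume.restrict (Ioo 0 T)), P t = D + ∫ s in Ioc 0 t, Φ s :=
    FunctionSpaces.ae_eq_add_setIntegral_of_forall_test hPi hΦi
      fun η hη _ _ => hu.test_smul_time hψ hdiv hη
  -- both sides are continuous on an open interval around `a`
  set U : Set ℝ := Ioo (max a₁ 0) (min a₂ T) with hU
  have haU : a ∈ U := ⟨max_lt ha.1 ha0, lt_min ha.2 haT⟩
  have hUT : U ⊆ Ioo 0 T := fun t ht =>
    ⟨(le_max_right _ _).trans_lt ht.1, ht.2.trans_le (min_le_right _ _)⟩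
  have hU12 : U ⊆ Icc a₁ a₂ := fun t ht =>
    ⟨(le_max_left _ _).trans ht.1.le, (ht.2.trans_le (min_le_left _ _)).le⟩
  have hPc : ContinuousOn P U := (continuousOn_integral_inner_test hc hψ).mono hU12
  have hΦi' : IntegrableOn Φ (Icc 0 T) := by rwa [integrableOn_Icc_iff_integrableOn_Ioo]
  have hGc : ContinuousOn (fun t => D + ∫ s in Ioc 0 t, Φ s) U := by
    have h := intervalIntegral.continuousOn_primitive_interval (μ := volume) (f := Φ) (a := 0)
      (b := T) (by rwa [uIcc_of_le hT.le])
    rw [uIcc_of_le hT.le] at h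
    refine ((continuousOn_const (c := D)).add (h.mono fun t ht => Ioo_subset_Icc_self (hUT ht))).congr
      fun t ht => ?_
    simp only [Pi.add_apply]
    rw [intervalIntegral.integral_of_le (hUT ht).1.le]
  have heq : EqOn P (fun t => D + ∫ s in Ioc 0 t, Φ s) U :=
    Measure.eqOn_open_of_ae_eq (ae_restrict_of_ae_restrict_of_subset hUT hae) isOpen_Ioo hPc hGc
  have h := heq haU
  simp only at h
  change P a = D + ∫ s in Ioo 0 a, Φ s
  rw [h, setIntegral_congr_set (Ioo_ae_eq_Ioc (α := ℝ))]

end Trace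

/-! ## Translation by `a` on the time axis (interval forms) -/

section Shift

omit [Fintype d] [DecidableEq d]

/-- The translation `t ↦ t - a` carries Lebesgue measure on `(a, T)` to Lebesgue measure on
`(0, T - a)`. [folklore] -/
theorem measurePreserving_sub_right_Ioo (a T : ℝ) :
    MeasurePreserving (fun t : ℝ => t - a) (volume.restrict (Ioo a T)) (volume.restrict (Ioo 0 (T - a))) := by
  have h := (measurePreserving_sub_right volume a).restrict_preimage
    (measurableSet_Ioo (a := (0 : ℝ)) (b := T - a))
  have hpre : (fun t : ℝ => t - a) ⁻¹' Ioo 0 (T - a) = Ioo a T := by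
    ext t
    simp only [mem_preimage, mem_Ioo]
    constructor <;> rintro ⟨h1, h2⟩ <;> constructor <;> linarith
  rwa [hpre] at h

/-- Change of variables `t ↦ t - a` in a Bochner integral over an interval:
`∫_{(a, T)} F(t - a) dt = ∫_{(0, T - a)} F`. [folklore] -/
theorem setIntegral_Ioo_comp_sub_right {E : Type*} [NormedAddCommGroup E] [NormedSpace ℝ E]
    (F : ℝ → E) (a T : ℝ) : ∫ t in Ioo a T, F (t - a) = ∫ t in Ioo 0 (T - a), F t :=
  (measurePreserving_sub_right_Ioo a T).integral_comp (MeasurableEquiv.subRight a).measurableEmbedding F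

/-- Change of variables `t ↦ t - a` in a lower integral over an interval:
`∫⁻_{(a, T)} g(t - a) dt = ∫⁻_{(0, T - a)} g`. [folklore] -/
theorem setLIntegral_Ioo_comp_sub_right' (g : ℝ → ℝ≥0∞) (a T : ℝ) :
    ∫⁻ t in Ioo a T, g (t - a) = ∫⁻ t in Ioo 0 (T - a), g t := by
  have h := setLIntegral_Ioo_comp_sub_right g 0 (T - a) a
  rwa [zero_add, sub_add_cancel] at h

/-- Transport of an a.e. statement along `t ↦ t - a`: if `P` holds a.e. on `(0, T - a)` then
`P (· - a)` holds a.e. on `(a, T)`. [folklore] -/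
theorem ae_restrict_Ioo_comp_sub_right' {a T : ℝ} {P : ℝ → Prop}
    (h : ∀ᵐ t ∂(volume.restrict (Ioo 0 (T - a))), P t) :
    ∀ᵐ t ∂(volume.restrict (Ioo a T)), P (t - a) := by
  have h2 := ae_restrict_Ioo_comp_sub_right a h
  rwa [zero_add, sub_add_cancel] at h2

/-- The time shear `(t, y) ↦ (t - a, y)` of `ℝ × ℝ^d` carries Lebesgue measure on
`(a, T) × ℝ^d` to Lebesgue measure on `(0, T - a) × ℝ^d`. [folklore] -/
theorem measurePreserving_prodMap_sub_right_Ioo [Fintype d] (a T : ℝ) :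
    MeasurePreserving (Prod.map (fun t : ℝ => t - a) (id : EuclideanSpace ℝ d → EuclideanSpace ℝ d))
      (volume.restrict (Ioo a T ×ˢ univ)) (volume.restrict (Ioo 0 (T - a) ×ˢ univ)) := by
  have h0 : MeasurePreserving (Prod.map (fun t : ℝ => t - a) (id : EuclideanSpace ℝ d → EuclideanSpace ℝ d))
      volume volume :=
    (measurePreserving_sub_right volume a).prod (MeasurePreserving.id volume)
  have h := h0.restrict_preimage ((measurableSet_Ioo (a := (0 : ℝ)) (b := T - a)).prod MeasurableSet.univ)
  have hpre : Prod.map (fun t : ℝ => t - a) (id : EuclideanSpace ℝ d → EuclideanSpace ℝ d) ⁻¹'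
      (Ioo 0 (T - a) ×ˢ univ) = Ioo a T ×ˢ univ := by
    ext p
    simp only [mem_preimage, mem_prod, Prod.map_fst, Prod.map_snd, mem_Ioo, mem_univ, and_true]
    constructor <;> rintro ⟨h1, h2⟩ <;> constructor <;> linarith
  rwa [hpre] at h

end Shift

/-! ## Gluing two weak solutions at an interior time -/

section Glue

variable {T ν : ℝ} {v w : ℝ → UnitAddTorus d → EuclideanSpace ℝ d} {u₀ : UnitAddTorus d → EuclideanSpace ℝ d}

omit [Fintype d] [DecidableEq d] in
/-- **Slicewise properties of a glued field**: if `P (v t)` holds for a.e. `t ∈ (0, T)` and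
`P (w t)` for a.e. `t ∈ (0, T - a)`, `0 < a < T`, then `P` holds for a.e. time slice in `(0, T)`
of the glued field `t ↦ v t` (`t ≤ a`), `w (t - a)` (`t > a`). [folklore] -/
theorem ae_restrict_glue {F : Type*} {v w : ℝ → F} {P : F → Prop} {a : ℝ} (ha0 : 0 < a) (haT : a < T)
    (hv : ∀ᵐ t ∂(volume.restrict (Ioo 0 T)), P (v t))
    (hw : ∀ᵐ t ∂(volume.restrict (Ioo 0 (T - a))), P (w t)) :
    ∀ᵐ t ∂(volume.restrict (Ioo 0 T)), P ((fun t => if t ≤ a then v t else w (t - a)) t) := by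
  have hTa : Ioo 0 T = Ioc 0 a ∪ Ioo a T := (Ioc_union_Ioo_eq_Ioo ha0.le haT).symm
  rw [hTa, ae_restrict_union_iff]
  constructor
  · have h1 : ∀ᵐ t ∂(volume.restrict (Ioc 0 a)), P (v t) :=
      ae_restrict_of_ae_restrict_of_subset (Ioc_subset_Ioo_right haT) hv
    filter_upwards [h1, ae_restrict_mem measurableSet_Ioc] with t ht htI
    simpa [htI.2] using ht
  · have h1 : ∀ᵐ t ∂(volume.restrict (Ioo a T)), P (w (t - a)) := ae_restrict_Ioo_comp_sub_right' hw
    filter_upwards [h1, ae_restrict_mem measurableSet_Ioo] with t ht htI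
    simpa [not_le.2 htI.1] using ht

omit [Fintype d] [DecidableEq d] in
/-- The `L^q` seminorm over `(0, T)` of a real function glued at `a ∈ (0, T)` from `g₁` on `(0, a]`
and `g₂(· - a)` on `(a, T)` is finite as soon as `‖g₁‖_{L^q(0,T)}` and `‖g₂‖_{L^q(0,T-a)}` are
(split the lower integral at `a` and translate). [folklore] -/
theorem eLpNorm_glue_lt_top {g₁ g₂ : ℝ → ℝ} {q : ℝ≥0∞} {a : ℝ} (ha0 : 0 < a) (haT : a < T)
    (h₁ : eLpNorm g₁ q (volume.restrict (Ioo 0 T)) < ⊤)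
    (h₂ : eLpNorm g₂ q (volume.restrict (Ioo 0 (T - a))) < ⊤) :
    eLpNorm (fun t => if t ≤ a then g₁ t else g₂ (t - a)) q (volume.restrict (Ioo 0 T)) < ⊤ := by
  by_cases hq0 : q = 0
  · simp [hq0]
  have hTa : Ioo 0 T = Ioc 0 a ∪ Ioo a T := (Ioc_union_Ioo_eq_Ioo ha0.le haT).symm
  by_cases hqt : q = ⊤
  · -- `q = ∞`: the essential supremum over `(0, T)` is at most the larger of the two
    subst hqt
    rw [eLpNorm_exponent_top] at h₁ h₂ ⊢
    rw [eLpNormEssSup_lt_top_iff_isBoundedUnder] at h₁ h₂ ⊢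
    obtain ⟨C₁, hC₁⟩ := h₁
    obtain ⟨C₂, hC₂⟩ := h₂
    refine ⟨max C₁ C₂, ?_⟩
    rw [Filter.eventually_map] at hC₁ hC₂ ⊢
    have hC₁' : ∀ᵐ t ∂(volume.restrict (Ioo 0 T)), ‖g₁ t‖₊ ≤ C₁ := hC₁
    have hC₂' : ∀ᵐ t ∂(volume.restrict (Ioo 0 (T - a))), ‖g₂ t‖₊ ≤ C₂ := hC₂
    have h := ae_restrict_glue (P := fun x : ℝ => ‖x‖₊ ≤ max C₁ C₂) ha0 haT
      (hC₁'.mono fun t ht => ht.trans (le_max_left _ _)) (hC₂'.mono fun t ht => ht.trans (le_max_right _ _))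
    exact h
  · rw [eLpNorm_lt_top_iff_lintegral_rpow_enorm_lt_top hq0 hqt] at h₁ h₂ ⊢
    rw [hTa]
    refine (lintegral_union_le _ _ _).trans_lt (ENNReal.add_lt_top.2 ⟨?_, ?_⟩)
    · calc ∫⁻ t in Ioc 0 a, ‖(fun t => if t ≤ a then g₁ t else g₂ (t - a)) t‖ₑ ^ q.toReal
          = ∫⁻ t in Ioc 0 a, ‖g₁ t‖ₑ ^ q.toReal :=
            setLIntegral_congr_fun measurableSet_Ioc fun t ht => by simp [ht.2]
        _ ≤ ∫⁻ t in Ioo 0 T, ‖g₁ t‖ₑ ^ q.toReal := lintegral_mono_set (Ioc_subset_Ioo_right haT)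
        _ < ⊤ := h₁
    · calc ∫⁻ t in Ioo a T, ‖(fun t => if t ≤ a then g₁ t else g₂ (t - a)) t‖ₑ ^ q.toReal
          = ∫⁻ t in Ioo a T, ‖g₂ (t - a)‖ₑ ^ q.toReal :=
            setLIntegral_congr_fun measurableSet_Ioo fun t ht => by simp [not_le.2 ht.1]
        _ = ∫⁻ t in Ioo 0 (T - a), ‖g₂ t‖ₑ ^ q.toReal :=
            setLIntegral_Ioo_comp_sub_right' (fun t => ‖g₂ t‖ₑ ^ q.toReal) a T
        _ < ⊤ := h₂

omit [DecidableEq d] in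
/-- **Mixed norms of a glued field**: if `v ∈ L^q(0, T; L^r(T^d))` and
`w ∈ L^q(0, T - a; L^r(T^d))` (guarded, `Torus.MemLqLp`), `0 < a < T`, then the glued field lies in
`L^q(0, T; L^r(T^d))`. [folklore] -/
theorem memLqLp_glue {F : Type*} [NormedAddCommGroup F] {v w : ℝ → UnitAddTorus d → F}
    {q r : ℝ≥0∞} {a : ℝ} (ha0 : 0 < a) (haT : a < T)
    (hv : MemLqLp q r v (Ioo 0 T)) (hw : MemLqLp q r w (Ioo 0 (T - a))) :
    MemLqLp q r (fun t => if t ≤ a then v t else w (t - a)) (Ioo 0 T) := by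
  refine ⟨ae_restrict_glue (P := fun f => MemLp f r volume) ha0 haT hv.1 hw.1, ?_⟩
  have h := eLpNorm_glue_lt_top (g₁ := fun t => (eLpNorm (v t) r volume).toReal)
    (g₂ := fun t => (eLpNorm (w t) r volume).toReal) ha0 haT hv.2 hw.2
  refine lt_of_eq_of_lt ?_ h
  refine eLpNorm_congr_ae (ae_of_all _ fun t => ?_)
  by_cases ht : t ≤ a <;> simp [ht]

omit [DecidableEq d] in
/-- **Space–time measurability of a glued field.** If `v` is space–time measurable on
`(0, T) × T^d` and `w` on `(0, T - a) × T^d`, `0 < a`, then the field `t ↦ v t` (`t ≤ a`),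
`w (t - a)` (`t > a`) is space–time measurable on `(0, T) × T^d`. [folklore] -/
theorem aestronglyMeasurable_stLift_glue {a : ℝ} (ha0 : 0 < a)
    (hv : AEStronglyMeasurable (FunctionSpaces.Torus.stLift v) (volume.restrict (Ioo 0 T ×ˢ univ)))
    (hw : AEStronglyMeasurable (FunctionSpaces.Torus.stLift w) (volume.restrict (Ioo 0 (T - a) ×ˢ univ))) :
    AEStronglyMeasurable (FunctionSpaces.Torus.stLift fun t => if t ≤ a then v t else w (t - a))
      (volume.restrict (Ioo 0 T ×ˢ (univ : Set (EuclideanSpace ℝ d)))) := by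
  set A : Set (ℝ × EuclideanSpace ℝ d) := {p | p.1 ≤ a} with hA
  have hAm : MeasurableSet A := measurableSet_le measurable_fst measurable_const
  have hdec : (FunctionSpaces.Torus.stLift fun t => if t ≤ a then v t else w (t - a)) =
      A.indicator (FunctionSpaces.Torus.stLift v) +
        Aᶜ.indicator (FunctionSpaces.Torus.stLift fun t => w (t - a)) := by
    funext p
    obtain ⟨t, y⟩ := p
    by_cases ht : t ≤ a
    · have hp : (t, y) ∈ A := ht
      simp [FunctionSpaces.Torus.stLift_apply, ht, indicator_of_mem hp, indicator_of_notMem (notMem_compl_iff.2 hp)]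
    · have hp : (t, y) ∉ A := ht
      simp [FunctionSpaces.Torus.stLift_apply, ht, indicator_of_notMem hp, indicator_of_mem (mem_compl hp)]
  rw [hdec]
  refine (hv.indicator hAm).add ?_
  rw [aestronglyMeasurable_indicator_iff hAm.compl, Measure.restrict_restrict hAm.compl]
  have hset : Aᶜ ∩ Ioo 0 T ×ˢ (univ : Set (EuclideanSpace ℝ d)) = Ioo a T ×ˢ univ := by
    ext p
    obtain ⟨t, y⟩ := p
    simp only [hA, mem_inter_iff, mem_compl_iff, mem_setOf_eq, not_le, mem_prod, mem_Ioo, mem_univ,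
      and_true]
    constructor
    · rintro ⟨h1, -, h3⟩
      exact ⟨h1, h3⟩
    · rintro ⟨h1, h2⟩
      exact ⟨h1, ha0.trans h1, h2⟩
  rw [hset]
  have hg : (FunctionSpaces.Torus.stLift fun t => w (t - a)) =
      FunctionSpaces.Torus.stLift w ∘ Prod.map (fun t : ℝ => t - a) id := by
    funext p
    rfl
  rw [hg]
  exact hw.comp_measurePreserving (measurePreserving_prodMap_sub_right_Ioo a T)

omit [DecidableEq d] in
/-- **Square integrability of a glued field** on `(0, T) × T^d` from that of the pieces. [folklore] -/
theorem lintegral_glue_lt_top {a : ℝ} (ha0 : 0 < a) (haT : a < T)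
    (hv : ∫⁻ t in Ioo 0 T, ∫⁻ x, ‖v t x‖ₑ ^ 2 < ⊤)
    (hw : ∫⁻ t in Ioo 0 (T - a), ∫⁻ x, ‖w t x‖ₑ ^ 2 < ⊤) :
    ∫⁻ t in Ioo 0 T, ∫⁻ x, ‖(fun t => if t ≤ a then v t else w (t - a)) t x‖ₑ ^ 2 < ⊤ := by
  have hTa : Ioo 0 T = Ioc 0 a ∪ Ioo a T := (Ioc_union_Ioo_eq_Ioo ha0.le haT).symm
  rw [hTa]
  refine (lintegral_union_le _ _ _).trans_lt (ENNReal.add_lt_top.2 ⟨?_, ?_⟩)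
  · calc ∫⁻ t in Ioc 0 a, ∫⁻ x, ‖(fun t => if t ≤ a then v t else w (t - a)) t x‖ₑ ^ 2
        = ∫⁻ t in Ioc 0 a, ∫⁻ x, ‖v t x‖ₑ ^ 2 :=
          setLIntegral_congr_fun measurableSet_Ioc fun t ht => by simp [ht.2]
      _ ≤ ∫⁻ t in Ioo 0 T, ∫⁻ x, ‖v t x‖ₑ ^ 2 := lintegral_mono_set (Ioc_subset_Ioo_right haT)
      _ < ⊤ := hv
  · calc ∫⁻ t in Ioo a T, ∫⁻ x, ‖(fun t => if t ≤ a then v t else w (t - a)) t x‖ₑ ^ 2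
        = ∫⁻ t in Ioo a T, ∫⁻ x, ‖w (t - a) x‖ₑ ^ 2 :=
          setLIntegral_congr_fun measurableSet_Ioo fun t ht => by simp [not_le.2 ht.1]
      _ = ∫⁻ t in Ioo 0 (T - a), ∫⁻ x, ‖w t x‖ₑ ^ 2 :=
          setLIntegral_Ioo_comp_sub_right' (fun t => ∫⁻ x, ‖w t x‖ₑ ^ 2) a T
      _ < ⊤ := hw

/-- **Gluing weak solutions in time.** Let `v` be a weak solution of Navier–Stokes (viscosity `ν`)
with datum `u₀` on `T^d × [0, T)` whose space–time lift is continuous on a slab `[a₁, a₂] × ℝ^d`,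
let `a ∈ (a₁, a₂)` with `0 < a < T`, and let `w` be a weak solution on `T^d × [0, T - a)` with
datum `v(a)`. Then the glued field `u(t) = v(t)` for `t ≤ a`, `u(t) = w(t - a)` for `t > a`, is a
weak solution on `T^d × [0, T)` with datum `u₀`. Proof: the weak-form functional of `u` against a
test field `ψ` is integrable on `(0, T)` and splits at `a`; on `(0, a)` it is that of `v`, whose
integral is `∫⟪v(a), ψ(a)⟫ - ∫⟪u₀, ψ(0)⟫` by the trace identity
(`integral_inner_eq_of_continuousOn`); on `(a, T)` it is, after the translation `t ↦ t - a`, that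
of `w` against the test field `ψ(· + a)` on `[0, T - a)`, whose integral is `-∫⟪v(a), ψ(a)⟫` by
the weak identity of `w` (Cheskidov–Luo 2022, §2.6: "the glued solution is still a weak
solution"; Temam 1984, Ch. III §1.1). [folklore] -/
theorem _root_.Literature.Analysis.FunctionSpaces.Torus.IsWeakNSSolutionWithDataOn.glue
    (hv : FunctionSpaces.Torus.IsWeakNSSolutionWithDataOn T ν u₀ v) {a a₁ a₂ : ℝ} (ha0 : 0 < a) (haT : a < T)
    (ha : a ∈ Ioo a₁ a₂) (hc : ContinuousOn (FunctionSpaces.Torus.stLift v) (Icc a₁ a₂ ×ˢ univ))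
    (hw : FunctionSpaces.Torus.IsWeakNSSolutionWithDataOn (T - a) ν (v a) w) :
    FunctionSpaces.Torus.IsWeakNSSolutionWithDataOn T ν u₀ (fun t => if t ≤ a then v t else w (t - a)) := by
  set u : ℝ → UnitAddTorus d → EuclideanSpace ℝ d := fun t => if t ≤ a then v t else w (t - a) with hu
  have hm := aestronglyMeasurable_stLift_glue (T := T) ha0 hv.1 hw.1
  have h2 := lintegral_glue_lt_top ha0 haT hv.2.1 hw.2.1
  have hTa : Ioo 0 T = Ioc 0 a ∪ Ioo a T := (Ioc_union_Ioo_eq_Ioo ha0.le haT).symm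
  have hva : ∀ t ∈ Ioc 0 a, u t = v t := fun t ht => by simp [hu, ht.2]
  have hwa : ∀ t ∈ Ioo a T, u t = w (t - a) := fun t ht => by simp [hu, not_le.2 ht.1]
  refine ⟨hm, h2, ?_, fun ψ hψ hdiv => ?_⟩
  · -- weak incompressibility for a.e. `t`
    exact ae_restrict_glue (P := FunctionSpaces.Torus.IsWeaklyDivFree) ha0 haT hv.2.2.1 hw.2.2.1
  · -- the weak identity
    set Φ : ℝ → ℝ := fun t => ∫ x, (⟪u t x, FunctionSpaces.Torus.timeDeriv ψ t x⟫_ℝ +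
      ⟪u t x, FunctionSpaces.Torus.convect (u t) (ψ t) x⟫_ℝ +
      ν * ⟪u t x, FunctionSpaces.Torus.laplacian (ψ t) x⟫_ℝ) with hΦ
    have hΦi : IntegrableOn Φ (Ioo 0 T) := integrableOn_nsWeakFunctional hm h2 hψ
    -- the translated test field on `[0, T - a)`
    set ψ' : ℝ → UnitAddTorus d → EuclideanSpace ℝ d := fun s => ψ (s + a) with hψ'
    have hψ't : FunctionSpaces.Torus.IsSpaceTimeTest (T - a) ψ' := hψ.comp_add_right a
    have hdiv' : FunctionSpaces.Torus.IsDivFreeTest ψ' := fun s => hdiv (s + a)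
    set Φ' : ℝ → ℝ := fun s => ∫ x, (⟪w s x, FunctionSpaces.Torus.timeDeriv ψ' s x⟫_ℝ +
      ⟪w s x, FunctionSpaces.Torus.convect (w s) (ψ' s) x⟫_ℝ +
      ν * ⟪w s x, FunctionSpaces.Torus.laplacian (ψ' s) x⟫_ℝ) with hΦ'
    have hw_id : (∫ s in Ioo 0 (T - a), Φ' s) + ∫ x, ⟪v a x, ψ a x⟫_ℝ = 0 := by
      have h := hw.2.2.2 ψ' hψ't hdiv'
      simpa only [hψ', zero_add] using h
    -- the piece on `(0, a]`
    have hleft : ∫ t in Ioc 0 a, Φ t = (∫ x, ⟪v a x, ψ a x⟫_ℝ) - ∫ x, ⟪u₀ x, ψ 0 x⟫_ℝ := by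
      have htr := hv.integral_inner_eq_of_continuousOn ha0 haT ha hc hψ hdiv
      rw [← setIntegral_congr_set (Ioo_ae_eq_Ioc (α := ℝ))]
      rw [setIntegral_congr_fun measurableSet_Ioo (g := fun t => ∫ x,
        (⟪v t x, FunctionSpaces.Torus.timeDeriv ψ t x⟫_ℝ + ⟪v t x, FunctionSpaces.Torus.convect (v t) (ψ t) x⟫_ℝ +
          ν * ⟪v t x, FunctionSpaces.Torus.laplacian (ψ t) x⟫_ℝ)) fun t ht => by
        simp only [hΦ, hva t ⟨ht.1, ht.2.le⟩]]
      linarith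
    -- the piece on `(a, T)`
    have hright : ∫ t in Ioo a T, Φ t = ∫ s in Ioo 0 (T - a), Φ' s := by
      rw [← setIntegral_Ioo_comp_sub_right Φ' a T]
      refine setIntegral_congr_fun measurableSet_Ioo fun t ht => ?_
      have hts : ψ t = ψ' (t - a) := by simp only [hψ', sub_add_cancel]
      have htd : ∀ x, FunctionSpaces.Torus.timeDeriv ψ t x = FunctionSpaces.Torus.timeDeriv ψ' (t - a) x := by
        intro x
        rw [hψ', timeDeriv_comp_add_right ψ a (t - a) x, sub_add_cancel]
      simp only [hΦ, hΦ']
      rw [hwa t ht]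
      refine integral_congr_ae (ae_of_all _ fun x => ?_)
      simp only [htd x, hts]
    rw [hTa, setIntegral_union ((Ioc_disjoint_Ioi (le_refl a)).mono_right Ioo_subset_Ioi_self) measurableSet_Ioo
      (hΦi.mono_set (by rw [hTa]; exact subset_union_left))
      (hΦi.mono_set (by rw [hTa]; exact subset_union_right)), hleft, hright]
    linarith

end Glue

end Torus

end Literature.Analysis.FluidPDE
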